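import Literature.NumberTheory.Automorphic.MatrixTwoConjugacy
import Mathlib.RingTheory.LocalRing.ResidueField.Basic
import HarnessLib

/-!
# Integral conjugacy of `2 × 2` matrices with non-scalar reduction (companion form over a local ring)

Topic `NumberTheory/Automorphic`; theorems only (no definition, no named fact, no instance).
Continuation of `MatrixTwoConjugacy` (rational canonical form `A [v | Av] = [v | Av] C(A)` over a
commutative ring, `mul_cyclic_eq_cyclic_mul_companion`; cyclic vectors over a field,
`exists_det_cyclic_ne_zero`) from fields to **local rings**:

* `eq_conj_companion_of_isUnit_det_cyclic`, `exists_units_conj_eq_of_isUnit_det_cyclic` — over any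
  commutative ring, a matrix with a cyclic vector `v` (`[v | Av] ∈ GL₂(R)`) is `GL₂(R)`-conjugate to its
  companion matrix, so two such matrices with the same trace and determinant are `GL₂(R)`-conjugate;
* `exists_isUnit_det_cyclic` — over a local ring a cyclic vector exists as soon as the reduction of
  `A` modulo the maximal ideal is not scalar (lift a cyclic vector of the reduction: a determinant is
  a unit iff its residue is non-zero), in particular when the discriminant `tr(A)² - 4 det(A)` is a
  unit (`map_residue_not_mem_bot_of_isUnit_discr`);
* `exists_units_conj_eq_of_isUnit_discr` — **over a local ring `R`, two `2 × 2` matrices with the same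
  trace `t` and determinant `n` and unit discriminant `t² - 4n` are conjugate by an element of
  `GL₂(R)`.**

This is the integrality statement behind the conjugacy *in `GL₂(𝔸_K^S)`* of two regular elliptic
elements with the same characteristic polynomial (at almost all places both are `𝒪_w`-integral with
unit discriminant), used implicitly in the comparison of the elliptic terms of the trace formulas
for `Dˣ` and `GL₂` (Gelbart (1975), §10, p. 155: the orbital integrals over `B^S \ G^S = B'^S \ G'^S`
are identified). Part of the inline (D-0026) decomposition of
`Literature.NumberTheory.Automorphic.strong_multiplicity_one_quaternionUnits`.

## References

* S. Gelbart, *Automorphic forms on adele groups*, Ann. of Math. Studies 83 (1975), §10, p. 155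
  [Gelbart1975].
* (Folklore linear algebra: a matrix with a cyclic vector is conjugate to its companion matrix;
  Bourbaki, *Algèbre* Ch. III §8.)
-/

namespace Literature.NumberTheory.Automorphic

open Matrix

section CommRing

variable {R : Type*} [CommRing R]

/-- `[v | Av]` is natural in the ring: `map f [v | A v] = [f v | (map f A)(f v)]`. [folklore] -/
theorem map_cyclic {S : Type*} [CommRing S] (f : R →+* S) (A : Matrix (Fin 2) (Fin 2) R) (v : Fin 2 → R) :
    (!![v 0, (A *ᵥ v) 0; v 1, (A *ᵥ v) 1] : Matrix (Fin 2) (Fin 2) R).map f =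
      !![(f ∘ v) 0, (A.map f *ᵥ (f ∘ v)) 0; (f ∘ v) 1, (A.map f *ᵥ (f ∘ v)) 1] := by
  ext i j
  fin_cases i <;> fin_cases j <;>
    simp [Matrix.mulVec, dotProduct, Fin.sum_univ_two, map_add, map_mul]

/-- **Companion form over `GL₂(R)`**: if `[v | Av]` has unit determinant then `A = P C(A) P⁻¹` with
`P = [v | Av] ∈ GL₂(R)`, `C(A) = (0, -det A; 1, tr A)` (`mul_cyclic_eq_cyclic_mul_companion`). [folklore] -/
theorem eq_conj_companion_of_isUnit_det_cyclic (A : Matrix (Fin 2) (Fin 2) R) (v : Fin 2 → R)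
    (h : IsUnit (!![v 0, (A *ᵥ v) 0; v 1, (A *ᵥ v) 1] : Matrix (Fin 2) (Fin 2) R).det) :
    ∃ P : GL (Fin 2) R, (P : Matrix (Fin 2) (Fin 2) R) = !![v 0, (A *ᵥ v) 0; v 1, (A *ᵥ v) 1] ∧
      A = (P : Matrix (Fin 2) (Fin 2) R) * !![0, -A.det; 1, A.trace] * ((P⁻¹ : GL (Fin 2) R) : Matrix (Fin 2) (Fin 2) R) := by
  have hP : IsUnit (!![v 0, (A *ᵥ v) 0; v 1, (A *ᵥ v) 1] : Matrix (Fin 2) (Fin 2) R) :=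
    (Matrix.isUnit_iff_isUnit_det _).2 h
  refine ⟨hP.unit, hP.unit_spec, ?_⟩
  have h1 : A * (hP.unit : Matrix (Fin 2) (Fin 2) R) = (hP.unit : Matrix (Fin 2) (Fin 2) R) * !![0, -A.det; 1, A.trace] := by
    rw [hP.unit_spec, mul_cyclic_eq_cyclic_mul_companion]
  calc A = A * (hP.unit : Matrix (Fin 2) (Fin 2) R) * ((hP.unit⁻¹ : (Matrix (Fin 2) (Fin 2) R)ˣ) : Matrix (Fin 2) (Fin 2) R) := by
        rw [mul_assoc, Units.mul_inv, mul_one]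
    _ = (hP.unit : Matrix (Fin 2) (Fin 2) R) * !![0, -A.det; 1, A.trace] *
        ((hP.unit⁻¹ : (Matrix (Fin 2) (Fin 2) R)ˣ) : Matrix (Fin 2) (Fin 2) R) := by rw [h1]

/-- **Two `2 × 2` matrices with cyclic vectors and the same trace and determinant are conjugate by an
element of `GL₂(R)`** (`Q = [w | Bw] [v | Av]⁻¹`). [folklore] -/
theorem exists_units_conj_eq_of_isUnit_det_cyclic (A B : Matrix (Fin 2) (Fin 2) R) (v w : Fin 2 → R)
    (hA : IsUnit (!![v 0, (A *ᵥ v) 0; v 1, (A *ᵥ v) 1] : Matrix (Fin 2) (Fin 2) R).det)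
    (hB : IsUnit (!![w 0, (B *ᵥ w) 0; w 1, (B *ᵥ w) 1] : Matrix (Fin 2) (Fin 2) R).det)
    (ht : A.trace = B.trace) (hd : A.det = B.det) :
    ∃ Q : GL (Fin 2) R, (Q : Matrix (Fin 2) (Fin 2) R) * A * ((Q⁻¹ : GL (Fin 2) R) : Matrix (Fin 2) (Fin 2) R) = B := by
  obtain ⟨P, -, hP⟩ := eq_conj_companion_of_isUnit_det_cyclic A v hA
  obtain ⟨P', -, hP'⟩ := eq_conj_companion_of_isUnit_det_cyclic B w hB
  refine ⟨P' * P⁻¹, ?_⟩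
  rw [ht, hd] at hP
  rw [hP', hP, Units.val_mul, _root_.mul_inv_rev, inv_inv, Units.val_mul]
  have h1 : ((P⁻¹ : GL (Fin 2) R) : Matrix (Fin 2) (Fin 2) R) * (P : Matrix (Fin 2) (Fin 2) R) = 1 := by
    rw [← Units.val_mul, inv_mul_cancel, Units.val_one]
  calc (P' : Matrix (Fin 2) (Fin 2) R) * ↑P⁻¹ * (↑P * !![0, -B.det; 1, B.trace] * ↑P⁻¹) * (↑P * ↑P'⁻¹)
      = ↑P' * (↑P⁻¹ * ↑P) * !![0, -B.det; 1, B.trace] * (↑P⁻¹ * ↑P) * ↑P'⁻¹ := by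
        simp only [mul_assoc]
    _ = ↑P' * !![0, -B.det; 1, B.trace] * ↑P'⁻¹ := by rw [h1, mul_one, mul_one]

end CommRing

/-! ### Cyclic vectors over a local ring by reduction -/

section LocalRing

variable {R : Type*} [CommRing R] [IsLocalRing R]

/-- **Over a local ring, a `2 × 2` matrix whose reduction is not scalar has a cyclic vector**
(`[v | Av] ∈ GL₂(R)`): lift a cyclic vector of the reduction (`exists_det_cyclic_ne_zero` over the
residue field); a determinant is a unit iff its residue is non-zero. [folklore] -/
theorem exists_isUnit_det_cyclic (A : Matrix (Fin 2) (Fin 2) R)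
    (hA : A.map (IsLocalRing.residue R) ∉
      (⊥ : Subalgebra (IsLocalRing.ResidueField R) (Matrix (Fin 2) (Fin 2) (IsLocalRing.ResidueField R)))) :
    ∃ v : Fin 2 → R, IsUnit (!![v 0, (A *ᵥ v) 0; v 1, (A *ᵥ v) 1] : Matrix (Fin 2) (Fin 2) R).det := by
  obtain ⟨u, hdet⟩ := exists_det_cyclic_ne_zero hA
  obtain ⟨v₀, hv₀⟩ := Ideal.Quotient.mk_surjective (u 0)
  obtain ⟨v₁, hv₁⟩ := Ideal.Quotient.mk_surjective (u 1)
  refine ⟨![v₀, v₁], ?_⟩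
  have hv : IsLocalRing.residue R ∘ ![v₀, v₁] = u := by
    ext i
    fin_cases i
    · exact hv₀
    · exact hv₁
  rw [← hv, ← map_cyclic, ← RingHom.mapMatrix_apply, ← RingHom.map_det] at hdet
  by_contra hnu
  exact hdet ((IsLocalRing.residue_eq_zero_iff _).2 ((IsLocalRing.mem_maximalIdeal _).2 hnu))

/-- **Unit discriminant forces non-scalar reduction**: if `tr(A)² - 4 det(A)` is a unit then the
reduction of `A` is not a scalar matrix (a scalar matrix `c · 1` has `tr² - 4 det = (2c)² - 4c² = 0`).
[folklore] -/
theorem map_residue_not_mem_bot_of_isUnit_discr (A : Matrix (Fin 2) (Fin 2) R) (h : IsUnit (A.trace ^ 2 - 4 * A.det)) :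
    A.map (IsLocalRing.residue R) ∉
      (⊥ : Subalgebra (IsLocalRing.ResidueField R) (Matrix (Fin 2) (Fin 2) (IsLocalRing.ResidueField R))) := by
  intro hmem
  obtain ⟨c, hc⟩ := Algebra.mem_bot.1 hmem
  rw [Algebra.algebraMap_eq_smul_one] at hc
  have e : ∀ i j, IsLocalRing.residue R (A i j) =
      (c • (1 : Matrix (Fin 2) (Fin 2) (IsLocalRing.ResidueField R))) i j := fun i j => by
    rw [hc]
    rfl
  have hres : IsLocalRing.residue R (A.trace ^ 2 - 4 * A.det) = 0 := by
    rw [Matrix.trace_fin_two, Matrix.det_fin_two]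
    simp only [map_sub, map_pow, map_mul, map_add, map_ofNat, e]
    simp [Matrix.smul_apply]
    ring
  have hmax : A.trace ^ 2 - 4 * A.det ∈ IsLocalRing.maximalIdeal R := (IsLocalRing.residue_eq_zero_iff _).1 hres
  exact (IsLocalRing.mem_maximalIdeal _).1 hmax h

/-- **Integral conjugacy**: over a local ring `R`, two `2 × 2` matrices with the same trace and
determinant whose common discriminant `tr² - 4 det` is a unit are conjugate by an element of `GL₂(R)`
(both have cyclic vectors and are `GL₂(R)`-conjugate to the same companion matrix). For `R = 𝒪_w` this
is the integrality, at almost every place, of the conjugation between two regular elliptic elements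
with the same characteristic polynomial. [folklore] -/
theorem exists_units_conj_eq_of_isUnit_discr (A B : Matrix (Fin 2) (Fin 2) R) (ht : A.trace = B.trace) (hd : A.det = B.det)
    (h : IsUnit (A.trace ^ 2 - 4 * A.det)) :
    ∃ Q : GL (Fin 2) R, (Q : Matrix (Fin 2) (Fin 2) R) * A * ((Q⁻¹ : GL (Fin 2) R) : Matrix (Fin 2) (Fin 2) R) = B := by
  obtain ⟨v, hv⟩ := exists_isUnit_det_cyclic A (map_residue_not_mem_bot_of_isUnit_discr A h)
  have hB : IsUnit (B.trace ^ 2 - 4 * B.det) := by rwa [← ht, ← hd]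
  obtain ⟨w, hw⟩ := exists_isUnit_det_cyclic B (map_residue_not_mem_bot_of_isUnit_discr B hB)
  exact exists_units_conj_eq_of_isUnit_det_cyclic A B v w hv hw ht hd

end LocalRing

end Literature.NumberTheory.Automorphic
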